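import Summits.HubbardSuperconductivity.HubbardSuperconductivity.Theorems.AnisotropyChordTransferFibre3FinX3Eval

/-!
# Route `AnisotropyChord` / H0 rotor rung: FIN per-`L` GM₃ (X5), `L = 28` — rows `N₁` / D / side-condition cell facts, part `p44`

Kernel facts (`decide +kernel`) for cert cells 107, 108 of the per-`L` grid of `L = 28`: `xbnCellAny2` (row `N₁` on XB2 point wedges recomputed in the kernel, exporting the literal brackets `nt ⊇ T⁺ − 3λ₂` and `tb ⊇ T⁺·D`), `xdCellAnyN0` (row D, reads `nt`), `sdCellAnyZN` (side condition, reads `nt`); evaluators `…FinX3Eval` / `…FinX5Eval`; constants from the compiled design probe (x3probe/x3plan, margins c ×0.985, b ×1.03, aD ×1.03); assembled in `…FinX5GM3TwentyEight`.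
Prover seat `hubbard-h0-rotor-p3` g8; helper for piece A = stmt-HubbardSuperconductivity-23918 of rung 19089 (`--supports`, helper class).
WHAT THIS IS NOT: nothing here proves superconductivity in the Hubbard model (rotor TARGET as worded stays FALSE, g15 verdict); kernel facts for the FIN certificate of ONE conditional reduction.  Tree imports only; zero data; standard axioms.
-/

set_option linter.dupNamespace false
set_option autoImplicit false

namespace Summit.HubbardSuperconductivity.HubbardSuperconductivity.Theorems.AnisotropyChord.Transfer.Fibre3

namespace FinXD

open FinXB FinCell Hole2

set_option maxHeartbeats 4000000 in
/-- row `N₁` of cell 107 of `L = 28` (`c = 59/100`), exporting `nt`, `tb`. [folklore] -/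
theorem xn28_107 : xbnCellAny2 28 (49/50 : ℚ) 956609597384212 980524837318818 (59/100 : ℚ) ((5690620744190 : ℤ), (11672646775926 : ℤ)) ((2875501896851952 : ℤ), (2953264674777254 : ℤ)) = true := by decide +kernel

set_option maxHeartbeats 4000000 in
/-- row D of cell 107 of `L = 28` (`aD = 79/1000`). [folklore] -/
theorem xd28_107 : xdCellAnyN0 28 (49/50 : ℚ) 956609597384212 980524837318818 (79/1000 : ℚ) ((5690620744190 : ℤ), (11672646775926 : ℤ)) = true := by decide +kernel

set_option maxHeartbeats 4000000 in
/-- side condition of cell 107 of `L = 28` (`c, b = 84/100, aD`). [folklore] -/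
theorem sd28_107 : sdCellAnyZN 28 (49/50 : ℚ) 100 956609597384212 980524837318818 ((59/100 : ℚ), (84 : ℕ), (79/1000 : ℚ)) ((5690620744190 : ℤ), (11672646775926 : ℤ)) = true := by decide +kernel

set_option maxHeartbeats 4000000 in
/-- row `N₁` of cell 108 of `L = 28` (`c = 59/100`), exporting `nt`, `tb`. [folklore] -/
theorem xn28_108 : xbnCellAny2 28 (49/50 : ℚ) 980524837318818 1005037958251789 (59/100 : ℚ) ((6232457121312 : ℤ), (12361385604745 : ℤ)) ((2947789015131770 : ℤ), (3027493214306108 : ℤ)) = true := by decide +kernel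

set_option maxHeartbeats 4000000 in
/-- row D of cell 108 of `L = 28` (`aD = 79/1000`). [folklore] -/
theorem xd28_108 : xdCellAnyN0 28 (49/50 : ℚ) 980524837318818 1005037958251789 (79/1000 : ℚ) ((6232457121312 : ℤ), (12361385604745 : ℤ)) = true := by decide +kernel

set_option maxHeartbeats 4000000 in
/-- side condition of cell 108 of `L = 28` (`c, b = 85/100, aD`). [folklore] -/
theorem sd28_108 : sdCellAnyZN 28 (49/50 : ℚ) 100 980524837318818 1005037958251789 ((59/100 : ℚ), (85 : ℕ), (79/1000 : ℚ)) ((6232457121312 : ℤ), (12361385604745 : ℤ)) = true := by decide +kernel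

end FinXD

end Summit.HubbardSuperconductivity.HubbardSuperconductivity.Theorems.AnisotropyChord.Transfer.Fibre3
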